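import Literature.MathematicalPhysics.QuantumFieldTheory.Balaban1983to89.Node00.OpsYCubeProjectionG
import Literature.MathematicalPhysics.QuantumFieldTheory.Balaban1983to89.Node00.OpsYDeltaALocalAgree
import Literature.MathematicalPhysics.QuantumFieldTheory.Balaban1983to89.Node00.OpsYCubeDirInverseBond
import Literature.MathematicalPhysics.QuantumFieldTheory.Balaban1983to89.B9Eq357CubeLetters
import Literature.MathematicalPhysics.QuantumFieldTheory.Balaban1983to89.B9WalkLettersOps310
import Literature.MathematicalPhysics.QuantumFieldTheory.Balaban1983to89.B9CubeDirInverseBondLocalityY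
import Literature.MathematicalPhysics.QuantumFieldTheory.Balaban1983to89.B9Thm310CommutatorDataOfPlaquettes

/-!
# `Balaban1983to89.B9CubeDirInverseBondLocalityAtRecordY` — [Balaban1985BackgroundPropagators] p. 410 l. 14–15 ∕ p. 413 FOR THE DIRICHLET BOND INVERSE `G_□(U)`
# OF p. 409 l. 3–5 AT THE LETTERS OF RECORD, PART 2: the letters of record, the agreement predicate `AgreeDirBY`, the reading set `bondReadSetY`, and THE
# `hOagrA` ROW of the N06 (γ) heads from `agree310WalkYO` + two geometric inclusions + the averaging letter's law (L2)

T. Bałaban, *Propagators for lattice gauge theories in a background field*, Commun. Math. Phys. **99** (1985) 389–434 [Balaban1985BackgroundPropagators] = [B9]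
(held `paper:balaban1985-cmp99-background-propagators`; journal page = PDF page + 388): p. 410 l. 14–15 («the operators G′_□(U), … depend on U restricted to
Ω₀(□) ⊂ □̃⁵»), p. 413 («it depends on U restricted to X̃⁵»), p. 409 l. 1–5, (3.19) p. 393, (3.21) + (3.24) pp. 394–395, (3.25) p. 394, (3.10) p. 392, (3.2) p. 390;
T. Bałaban, *Averaging operations for lattice gauge theories*, Commun. Math. Phys. **98** (1985) 17–51 [Balaban1985Averaging]: p. 24 (locality sentence after (43)).

WHY THIS FILE (seat dag-n06-d g33, the KNIT lane of N06; sibling `B9CubeDirInverseBondLocalityY` = the generic half).  The (γ) heads of record display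
`hOagrA : agree310WalkYO x 𝔅 id (nearA x) □ U U′ → GDirBY … (DPDsDirCubeY x.toKIdx □ (dirDomY x.toKIdx □)) (bondsOverY …) U = … U′`.  Here: the cube chain of
record is operator-level local from bond agreement at the sites of `S` and of its `𝔅_□`-block hull (the legs `parKnitCubeY` read the cube block only —
dag-n06-c ✓`knitCubeY_congr_of_agree_block`; `G′_□` by dag-n06-d ✓`GpDirY_parKnitCubeY_congr_of_agree`), and `G_□(U) = G_□(U′)` follows from the agreement
predicate `AgreeDirBY i □ D S U U′` + (L2) `IsLocalQ D 𝔮` + `IsLocalQs D 𝔮⋆`; at a member, `agree310WalkYO near □` with `bondReadSetY x.toKIdx □ S ⊆ near □` and the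
dependency sets of `𝔮` meeting the bonds over `S` read inside `near □` gives `AgreeDirBY` — the `hOagrA` row becomes two GEOMETRIC inclusions and the law (L2).

WHAT IS PROVED (sorry-free; standard axioms; no estimate of the paper).
* §3 ★ `parKnitCubeY_corner_congr_of_agree_block`, `qpLegAgreeY_parKnitCubeY`, ★★ `PDirCubeY_congr_of_agree` ∕ `RDirCubeY_congr_of_agree` ∕
  `CDirCubeY_congr_of_agree` ∕ `XDirCubeY_congr_of_agree` ∕ `isUnitXDirCubeY_iff_of_agree` (OPERATOR level), the predicate ★ `AgreeDirBY` (`.bond`, `.dep`),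
  ★★★ `GDirBY_DPDsDirCubeY_congr` ∕ `padDeltaLocBY_DPDsDirCubeY_congr` ∕ `isUnit_padDeltaLocBY_DPDsDirCubeY_iff`.
* §4 ★ `bondReadSetY i □ S` (sites `S`, `S ± e_κ`, `S − e_κ + e_κ′`, the `𝔅_□`-block hull of `S`) with membership lemmas, `plaq_src_of_row` (the corner of a plaquette
  through `b` is `b₋`, `b₋ − e_μ` or `b₋ − e_ν`), ★★ `agreeDirBY_of_agree310WalkYO`, ★★★ `GDirBY_DPDsDirCubeY_congr_of_agree310WalkYO` (THE `hOagrA` ROW) and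
  `isUnit_padDeltaLocBY_DPDsDirCubeY_iff_of_agree310WalkYO` (the regime row `hUnitA` is reading-invariant likewise).

HONEST SCOPE.  Bookkeeping (support chasing) over def-Y's letters and the sibling; no analytic input.  The inclusions `bondReadSetY x.toKIdx □ (dirDomY x □) ⊆ nearA x □`
and «dependency sets meeting Ω₀(□) are read in nearA x □» are NOT asserted here (geometry of the cover, displayed by the consumer), nor is (L2) for the record's
knit letter packaged here.  Count-neutral; N06 NOT discharged; nothing continuum ∕ OS ∕ mass gap ∕ Clay.  NEW file; nothing landed is modified; no `instance`,
no `notation`; 2 `def`s (`AgreeDirBY` — an agreement predicate; `bondReadSetY` — a Finset).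
-/

noncomputable section

namespace Literature.MathematicalPhysics.QuantumFieldTheory.Balaban1983to89.B9CubeDirInverseBondLocalityAtRecordY

open B6KLevelCensusIndexV1 (KIdx)
open B6Cover236MultiLevelBlocks (cubes)
open B6Geom246MultiLevelBoxL0 (blkOf)
open B9Eq39Adjoint (R)
open B9CubeLettersOpsL0 (cubeFamY)
open B9CubeLettersBondOpsL0 (BlkCubeY blkCornerCubeY qpKc qpsKc qpTc QpCubeY QpsCubeY cWtCubeY)
open B9Eq357CubeLetters (blkOf_of_qpKc_ne_zero blkOf_of_qpsKc_ne_zero)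
open B9Eq360DeltaPrimeACubeY (cornerY_levCubeY_eq)
open B9CubeLettersOpsL0 (levCubeY)
open B6GlobalChartV1 (PV boxEquiv)
open B9Eq359CubeKernelsKnitAtOne (knitCubeY_congr_of_agree_block)
open B9Eq3105OfLocalInverseQ (deltaLocQY)
open B9Thm37CubeCoverCommutators (cutMulY)
open B9CubeDirInverseKnitCubeLawsY (blkHullCubeY mem_blkHullCubeY GpDirY_parKnitCubeY_congr_of_agree padDeltaCubeY_parKnitCubeY_congr_of_agree)
open B9PinMembersKLevelV1 (MemberY)
open B9Thm310CommutatorDataOfPlaquettes (UboxY_chartY)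
open B9CubeDirInverseBondLocalityY (QpLegAgreeY XCubeGY_congr PCubeDY_congr RCubeDY_congr CCubeDY_congr IsLocalQs q_congr_of_isLocalQ
  GDirBY_DPDsCubeDY_congr padDeltaLocBY_DPDsCubeDY_congr)
open B9WalkLettersOps310 (agree310WalkYO)
open Node00
open Node00.OpsYNablaBridge (chartY shiftY_chartY shiftY_symm_chartY)
open Node00.OpsYLocalInverse (dirPadY dirInvY dirInvY_congr cubeProjY cubeProjY_apply)
open Node00.OpsYDeltaALocalAgree (trLiftY_apply_congr trLiftY_apply_congr' PlaqAgreeY hessY_apply_congr gradY_apply_congr divY_apply_congr)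
open Node00.OpsYCubeDirInverse (GpDirY cubeProjY_mul_GpDirY GpDirY_mul_cubeProjY)
open Node00.OpsYCubeKnitPar (parKnitCubeY parKnitCubeY_apply parOfTL knitTL parOfTL_corner_left)
open Node00.OpsYCubeProjectionG (blkProjY insideBlkY XCubeGY XinvCubeDY PCubeDY RCubeDY CCubeDY DPDsCubeDY XDirCubeY IsUnitXDirCubeY RDirCubeY PDirCubeY
  CDirCubeY DPDsDirCubeY RCubeDY_eq DPDsCubeDY_eq_gradY_PCubeDY_divY)
open Node00.OpsYCubeDirInverseBond (indProjY bondsOverY mem_bondsOverY padDeltaLocBY GDirBY GDirBY_congr_of_apply padDeltaLocBY_congr_of_apply)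
open Node00.OpsYQLetter (QLetterY QsLetterY IsLocalQ adjTrY adjTrY_apply unitFnY qKnitOfRecord qsKnitOfRecord)
open scoped Matrix Matrix.Norms.L2Operator

variable {d ℓ : ℕ} {hd : 1 ≤ d + 1} {hL : Odd (ℓ + 1) ∧ 1 < ℓ + 1} {b₀ b₁ : ℝ}
variable {𝔸 : Type} [NormedRing 𝔸] [NormedAlgebra ℂ 𝔸] [CompleteSpace 𝔸]

/-! ## §3 At the letters OF RECORD: `parKnitCubeY i □`, `G′_□ = GpDirY i □ (parKnitCubeY i □) S`, cut `insideBlkY S` -/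

section OfRecord

variable (i : KIdx d ℓ hd hL b₀ b₁) (q : ↥(cubes (toKT i).D.toDomains))

/-- ★ **THE CUBE LETTER's CORNER LEG `parKnitCubeY U (c(s), w)`, `w ∈ s`, READS `U` ON THE BONDS INSIDE THE CUBE BLOCK `s`** (def-Y's `parOfTL_corner_left` + dag-n06-c's
✓`knitCubeY_congr_of_agree_block`). [cite: Balaban1985BackgroundPropagators, (3.19) p.393, (3.21) p.394, p.409 l.1–5; Balaban1985Averaging, p.24] -/
theorem parKnitCubeY_corner_congr_of_agree_block {U U' : CfgY 𝔸 i} {s : BlkCubeY i q} {w : SiteY i} (hw : blkOf (cubeFamY i q).toDomains w = s)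
    (h : ∀ (v : SiteY i) (μ : Fin (d + 1)), blkOf (cubeFamY i q).toDomains v = s → blkOf (cubeFamY i q).toDomains (shiftY i μ v) = s →
      UboxY i U μ v = UboxY i U' μ v) :
    parKnitCubeY i q U (blkCornerCubeY i q s) w = parKnitCubeY i q U' (blkCornerCubeY i q s) w := by
  have hc : cornerY i (levCubeY i q w) w = blkCornerCubeY i q s := by rw [cornerY_levCubeY_eq i q w]; exact congrArg _ hw
  rw [parKnitCubeY_apply, parKnitCubeY_apply, ← hc, parOfTL_corner_left, parOfTL_corner_left]
  exact knitCubeY_congr_of_agree_block i q w fun v μ hv hv' => h v μ (hv.trans hw) (hv'.trans hw)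

/-- ★ the `Q′_□`-legs of record agree on `S` once `U ≡ U′` at the bonds of the `𝔅_□`-block hull of `S`. [cite: Balaban1985BackgroundPropagators, (3.21) p.394, (3.24) p.395, p.394 L30–33] -/
theorem qpLegAgreeY_parKnitCubeY {S : Finset (SiteY i)} {U U' : CfgY 𝔸 i} (hR : ∀ v ∈ blkHullCubeY i q S, ∀ μ, UboxY i U μ v = UboxY i U' μ v) :
    QpLegAgreeY i q (parKnitCubeY i q) S U U' := fun z hz _ hs =>
  parKnitCubeY_corner_congr_of_agree_block i q hs fun v μ hv _ => hR v ((mem_blkHullCubeY i q).2 ⟨z, hz, hv.trans hs.symm⟩) μ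

variable {U U' : CfgY 𝔸 i}

/-- ★★ **`P_□(U) = P_□(U′)` AT THE LETTERS OF RECORD** from bond agreement at the sites of `S` (both directions) and of its `𝔅_□`-block hull — OPERATOR level.
[cite: Balaban1985BackgroundPropagators, (3.25) p.394, p.409 l.1–5, p.410 L14–15 («depend on U restricted to Ω₀(□)»)] -/
theorem PDirCubeY_congr_of_agree (S : Finset (SiteY i))
    (hU : ∀ z ∈ S, ∀ μ, UboxY i U μ z = UboxY i U' μ z ∧ UboxY i U μ ((shiftY i μ).symm z) = UboxY i U' μ ((shiftY i μ).symm z))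
    (hR : ∀ v ∈ blkHullCubeY i q S, ∀ μ, UboxY i U μ v = UboxY i U' μ v) : PDirCubeY i q S U = PDirCubeY i q S U' :=
  PCubeDY_congr (insideBlkY i q S) (GpDirY_parKnitCubeY_congr_of_agree i q S hU hR) (cubeProjY_mul_GpDirY i q _ S U') (GpDirY_mul_cubeProjY i q _ S U')
    (qpLegAgreeY_parKnitCubeY i q hR)

/-- ★ `R_□(U) = R_□(U′)` at the letters of record. [cite: Balaban1985BackgroundPropagators, (3.25) p.394, p.409 l.1–5, p.410 L14–15] -/
theorem RDirCubeY_congr_of_agree (S : Finset (SiteY i))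
    (hU : ∀ z ∈ S, ∀ μ, UboxY i U μ z = UboxY i U' μ z ∧ UboxY i U μ ((shiftY i μ).symm z) = UboxY i U' μ ((shiftY i μ).symm z))
    (hR : ∀ v ∈ blkHullCubeY i q S, ∀ μ, UboxY i U μ v = UboxY i U' μ v) : RDirCubeY i q S U = RDirCubeY i q S U' :=
  RCubeDY_congr (insideBlkY i q S) (GpDirY_parKnitCubeY_congr_of_agree i q S hU hR) (cubeProjY_mul_GpDirY i q _ S U') (GpDirY_mul_cubeProjY i q _ S U')
    (qpLegAgreeY_parKnitCubeY i q hR)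

/-- ★ `C_□(U) = C_□(U′)` at the letters of record. [cite: Balaban1985BackgroundPropagators, (3.48) p.398, p.409 l.1–5, p.410 L14–15] -/
theorem CDirCubeY_congr_of_agree (S : Finset (SiteY i))
    (hU : ∀ z ∈ S, ∀ μ, UboxY i U μ z = UboxY i U' μ z ∧ UboxY i U μ ((shiftY i μ).symm z) = UboxY i U' μ ((shiftY i μ).symm z))
    (hR : ∀ v ∈ blkHullCubeY i q S, ∀ μ, UboxY i U μ v = UboxY i U' μ v) : CDirCubeY i q S U = CDirCubeY i q S U' :=
  CCubeDY_congr (insideBlkY i q S) (GpDirY_parKnitCubeY_congr_of_agree i q S hU hR) (cubeProjY_mul_GpDirY i q _ S U') (GpDirY_mul_cubeProjY i q _ S U')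
    (qpLegAgreeY_parKnitCubeY i q hR)

/-- ★ `X_□(U) = X_□(U′)` at the letters of record. [cite: Balaban1985BackgroundPropagators, (3.25) p.394, p.409 l.1–5, p.410 L14–15] -/
theorem XDirCubeY_congr_of_agree (S : Finset (SiteY i))
    (hU : ∀ z ∈ S, ∀ μ, UboxY i U μ z = UboxY i U' μ z ∧ UboxY i U μ ((shiftY i μ).symm z) = UboxY i U' μ ((shiftY i μ).symm z))
    (hR : ∀ v ∈ blkHullCubeY i q S, ∀ μ, UboxY i U μ v = UboxY i U' μ v) : XDirCubeY i q S U = XDirCubeY i q S U' :=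
  XCubeGY_congr (GpDirY_parKnitCubeY_congr_of_agree i q S hU hR) (cubeProjY_mul_GpDirY i q _ S U') (GpDirY_mul_cubeProjY i q _ S U')
    (qpLegAgreeY_parKnitCubeY i q hR)

/-- hence the regime hypotheses of record agree: `IsUnitXDirCubeY i □ S U ↔ IsUnitXDirCubeY i □ S U′`. [cite: Balaban1985BackgroundPropagators, (3.25) p.394, p.409 l.1–5, bookkeeping] -/
theorem isUnitXDirCubeY_iff_of_agree (S : Finset (SiteY i))
    (hU : ∀ z ∈ S, ∀ μ, UboxY i U μ z = UboxY i U' μ z ∧ UboxY i U μ ((shiftY i μ).symm z) = UboxY i U' μ ((shiftY i μ).symm z))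
    (hR : ∀ v ∈ blkHullCubeY i q S, ∀ μ, UboxY i U μ v = UboxY i U' μ v) : IsUnitXDirCubeY i q S U ↔ IsUnitXDirCubeY i q S U' := by
  rw [IsUnitXDirCubeY, IsUnitXDirCubeY, XDirCubeY_congr_of_agree i q S hU hR]

/-- ★★ **THE AGREEMENT PREDICATE OF THE BOND LETTER OF RECORD** `AgreeDirBY i □ D S U U′` — `U = U′` on exactly what
`G_□(U) = GDirBY 𝔮 𝔮⋆ (DPDsDirCubeY i □ S) (bondsOverY S) U` reads: (i) the bonds at the sites of `S` (both directions: `G′_□`, `D_U`, `D*_U`) and (ii) at the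
sites of the `𝔅_□`-block hull of `S` (the legs of `Δ′_{a,□}` and `Q′_□`); (iii) the edges of the plaquettes of the Hessian's rows through the bonds over `S`;
(iv) the dependency sets `D ι` of the averaging letter meeting the bonds over `S` (`𝔮`, `𝔮⋆`).  Print: all of it lies in `□̃⁵` — the geometric inclusion is
§4's reading set, NOT asserted here. [cite: Balaban1985BackgroundPropagators, p.410 L14–15, p.413, p.409 l.1–5, dictionary] -/
def AgreeDirBY (D : IBondY i → Set (FBondY i)) (S : Finset (SiteY i)) (U U' : CfgY 𝔸 i) : Prop :=
  (∀ z ∈ S, ∀ μ, UboxY i U μ z = UboxY i U' μ z ∧ UboxY i U μ ((shiftY i μ).symm z) = UboxY i U' μ ((shiftY i μ).symm z)) ∧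
  (∀ v ∈ blkHullCubeY i q S, ∀ μ, UboxY i U μ v = UboxY i U' μ v) ∧
  (∀ b : FBondY i, chartY i b.src ∈ S → ∀ p, (cocurlK i b p ≠ 0 ∨ ∃ m, edgeY i p m = b) → PlaqAgreeY i U U' p) ∧
  (∀ ι, (∃ b ∈ D ι, chartY i b.src ∈ S) → ∀ b ∈ D ι, U b.dir b.src = U' b.dir b.src)

variable {i q}

/-- clause (i) gives the bond agreement over `S` in torus coordinates. [cite: Balaban1985BackgroundPropagators, (3.3) p.390, dictionary] -/
theorem AgreeDirBY.bond {D : IBondY i → Set (FBondY i)} {S : Finset (SiteY i)} (h : AgreeDirBY i q D S U U') (b : FBondY i) (hb : chartY i b.src ∈ S) :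
    U b.dir b.src = U' b.dir b.src := by
  rw [← UboxY_chartY i U, ← UboxY_chartY i U']
  exact (h.1 _ hb b.dir).1

/-- clause (iv) gives the row-locality premise of `𝔮⋆` at every bond over `S`. [cite: Balaban1985BackgroundPropagators, (3.13) p.393, p.413, bookkeeping] -/
theorem AgreeDirBY.dep {D : IBondY i → Set (FBondY i)} {S : Finset (SiteY i)} (h : AgreeDirBY i q D S U U') {b : FBondY i} (hb : chartY i b.src ∈ S) :
    ∀ ι, b ∈ D ι → ∀ b' ∈ D ι, U b'.dir b'.src = U' b'.dir b'.src := fun ι hι =>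
  h.2.2.2 ι ⟨b, hι, hb⟩

variable (i q)

/-- ★★★ **`G_□(U) = G_□(U′)` AT THE LETTERS OF RECORD** — print's «`G_□(U)` depends on `U` restricted to `Ω₀(□)`» for the Dirichlet bond inverse of p. 409 l. 3–5 with
`Pl_□ = D P_□ D*` of record and `B = bondsOverY S`: from `AgreeDirBY i □ D S U U′`, the (L2) law `IsLocalQ D 𝔮` and the row locality `IsLocalQs D 𝔮⋆`.
[cite: Balaban1985BackgroundPropagators, p.409 l.3–5 («G_□(U)»), p.410 L14–15, p.413, (3.105) p.414] -/
theorem GDirBY_DPDsDirCubeY_congr {D : IBondY i → Set (FBondY i)} {𝔮 : QLetterY 𝔸 i} {𝔮s : QsLetterY 𝔸 i} (hloc : IsLocalQ D 𝔮) (hlocs : IsLocalQs i D 𝔮s)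
    (S : Finset (SiteY i)) (h : AgreeDirBY i q D S U U') :
    GDirBY i 𝔮 𝔮s (DPDsDirCubeY i q S) (bondsOverY i S) U = GDirBY i 𝔮 𝔮s (DPDsDirCubeY i q S) (bondsOverY i S) U' :=
  GDirBY_DPDsCubeDY_congr (insideBlkY i q S) (PDirCubeY_congr_of_agree i q S h.1 h.2.1) (GpDirY_mul_cubeProjY i q _ S U') h.bond h.2.2.1
    (fun _ hA => q_congr_of_isLocalQ hloc (fun ι ⟨b, hb, hbB⟩ => h.2.2.2 ι ⟨b, hb, (mem_bondsOverY i).1 hbB⟩) hA)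
    (fun _ hb => hlocs U U' _ (h.dep hb))

/-- ★★ and the regime object of record agrees: `padDeltaLocBY … U = padDeltaLocBY … U′`. [cite: Balaban1985BackgroundPropagators, p.409 l.3–5, p.410 L14–15, bookkeeping] -/
theorem padDeltaLocBY_DPDsDirCubeY_congr {D : IBondY i → Set (FBondY i)} {𝔮 : QLetterY 𝔸 i} {𝔮s : QsLetterY 𝔸 i} (hloc : IsLocalQ D 𝔮)
    (hlocs : IsLocalQs i D 𝔮s) (S : Finset (SiteY i)) (h : AgreeDirBY i q D S U U') :
    padDeltaLocBY i 𝔮 𝔮s (DPDsDirCubeY i q S) (bondsOverY i S) U = padDeltaLocBY i 𝔮 𝔮s (DPDsDirCubeY i q S) (bondsOverY i S) U' :=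
  padDeltaLocBY_DPDsCubeDY_congr (insideBlkY i q S) (PDirCubeY_congr_of_agree i q S h.1 h.2.1) (GpDirY_mul_cubeProjY i q _ S U') h.bond h.2.2.1
    (fun _ hA => q_congr_of_isLocalQ hloc (fun ι ⟨b, hb, hbB⟩ => h.2.2.2 ι ⟨b, hb, (mem_bondsOverY i).1 hbB⟩) hA)
    (fun _ hb => hlocs U U' _ (h.dep hb))

/-- ★ hence the regime hypotheses `hUnitA` of record agree: `IsUnit (padDeltaLocBY … U) ↔ IsUnit (padDeltaLocBY … U′)`. [cite: Balaban1985BackgroundPropagators, p.409 l.3–5, Cor. 3.6 p.408, bookkeeping] -/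
theorem isUnit_padDeltaLocBY_DPDsDirCubeY_iff {D : IBondY i → Set (FBondY i)} {𝔮 : QLetterY 𝔸 i} {𝔮s : QsLetterY 𝔸 i} (hloc : IsLocalQ D 𝔮)
    (hlocs : IsLocalQs i D 𝔮s) (S : Finset (SiteY i)) (h : AgreeDirBY i q D S U U') :
    IsUnit (padDeltaLocBY i 𝔮 𝔮s (DPDsDirCubeY i q S) (bondsOverY i S) U) ↔ IsUnit (padDeltaLocBY i 𝔮 𝔮s (DPDsDirCubeY i q S) (bondsOverY i S) U') := by
  rw [padDeltaLocBY_DPDsDirCubeY_congr i q hloc hlocs S h]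

end OfRecord

/-! ## §4 At a member: the reading set of sites and the `hOagrA` row from `agree310WalkYO` -/

section ReadSet

variable (i : KIdx d ℓ hd hL b₀ b₁) (q : ↥(cubes (toKT i).D.toDomains))

/-- ★ **THE READING SET OF SITES OF `G_□(U)` OVER `S = Ω₀(□)`** (clauses (i)–(iii) of `AgreeDirBY`): the sites of `S`, their translates `z + e_κ`, `z − e_κ`,
`z − e_κ + e_κ′` (the corners of the plaquettes through the bonds at `z` and their forward edges), and the `𝔅_□`-block hull of `S`.
[cite: Balaban1985BackgroundPropagators, p.410 L14–15 («Ω₀(□) ⊂ □̃⁵»), (3.10) p.392, p.394 L30–33, dictionary] -/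
def bondReadSetY (S : Finset (SiteY i)) : Finset (SiteY i) :=
  S ∪ (Finset.univ ×ˢ S).image (fun p : Fin (d + 1) × SiteY i => shiftY i p.1 p.2) ∪
    (Finset.univ ×ˢ S).image (fun p : Fin (d + 1) × SiteY i => (shiftY i p.1).symm p.2) ∪
    ((Finset.univ ×ˢ Finset.univ) ×ˢ S).image (fun p : (Fin (d + 1) × Fin (d + 1)) × SiteY i => shiftY i p.1.2 ((shiftY i p.1.1).symm p.2)) ∪
    blkHullCubeY i q S

variable {i q} {S : Finset (SiteY i)}

/-- `S ⊆ bondReadSetY S`. [cite: Balaban1985BackgroundPropagators, p.410 L14–15, bookkeeping] -/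
theorem mem_bondReadSetY_self {z : SiteY i} (hz : z ∈ S) : z ∈ bondReadSetY i q S := by
  unfold bondReadSetY
  simp only [Finset.mem_union]
  exact Or.inl (Or.inl (Or.inl (Or.inl hz)))

/-- `z + e_κ ∈ bondReadSetY S` for `z ∈ S`. [cite: Balaban1985BackgroundPropagators, p.410 L14–15, bookkeeping] -/
theorem shiftY_mem_bondReadSetY {z : SiteY i} (hz : z ∈ S) (κ : Fin (d + 1)) : shiftY i κ z ∈ bondReadSetY i q S := by
  unfold bondReadSetY
  simp only [Finset.mem_union]
  refine Or.inl (Or.inl (Or.inl (Or.inr ?_)))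
  exact Finset.mem_image.2 ⟨(κ, z), Finset.mem_product.2 ⟨Finset.mem_univ _, hz⟩, rfl⟩

/-- `z − e_κ ∈ bondReadSetY S` for `z ∈ S`. [cite: Balaban1985BackgroundPropagators, p.410 L14–15, bookkeeping] -/
theorem shiftY_symm_mem_bondReadSetY {z : SiteY i} (hz : z ∈ S) (κ : Fin (d + 1)) : (shiftY i κ).symm z ∈ bondReadSetY i q S := by
  unfold bondReadSetY
  simp only [Finset.mem_union]
  refine Or.inl (Or.inl (Or.inr ?_))
  exact Finset.mem_image.2 ⟨(κ, z), Finset.mem_product.2 ⟨Finset.mem_univ _, hz⟩, rfl⟩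

/-- `z − e_κ + e_κ′ ∈ bondReadSetY S` for `z ∈ S`. [cite: Balaban1985BackgroundPropagators, p.410 L14–15, bookkeeping] -/
theorem shiftY_shiftY_symm_mem_bondReadSetY {z : SiteY i} (hz : z ∈ S) (κ κ' : Fin (d + 1)) :
    shiftY i κ' ((shiftY i κ).symm z) ∈ bondReadSetY i q S := by
  unfold bondReadSetY
  simp only [Finset.mem_union]
  refine Or.inl (Or.inr ?_)
  exact Finset.mem_image.2 ⟨((κ, κ'), z), Finset.mem_product.2 ⟨Finset.mem_product.2 ⟨Finset.mem_univ _, Finset.mem_univ _⟩, hz⟩, rfl⟩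

/-- `blkHullCubeY S ⊆ bondReadSetY S`. [cite: Balaban1985BackgroundPropagators, p.394 L30–33, bookkeeping] -/
theorem mem_bondReadSetY_of_mem_blkHullCubeY {v : SiteY i} (hv : v ∈ blkHullCubeY i q S) : v ∈ bondReadSetY i q S := by
  unfold bondReadSetY
  simp only [Finset.mem_union]
  exact Or.inr hv

end ReadSet

section Member

variable {Mstar : ℕ} (x : MemberY d ℓ hd hL b₀ b₁ Mstar) (B : B9.Backgrounds) (cfg : B.Cfg → CfgY 𝔸 x.toKIdx) (c : ↥(cubes x.toKIdx.D.toDomains))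

/-- the corner of a plaquette through a bond `b` is `b₋`, `b₋ − e_μ` or `b₋ − e_ν`. [cite: Balaban1985BackgroundPropagators, (3.2) p.390, (3.9)–(3.10) p.392, bookkeeping] -/
theorem plaq_src_of_row {b : FBondY x.toKIdx} {p : PlaqY x.toKIdx} (h : cocurlK x.toKIdx b p ≠ 0 ∨ ∃ m, edgeY x.toKIdx p m = b) :
    p.src = b.src ∨ p.src = b.src.unshift p.μ ∨ p.src = b.src.unshift p.ν := by
  have key : b.src = p.src ∨ b.src = p.src.shift p.μ ∨ b.src = p.src.shift p.ν := by
    rcases h with h | ⟨m, hm⟩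
    · rw [cocurlK_eq_transpose, Matrix.transpose_apply] at h
      exact B9Eq3104CutoffCommutatorSizes.src_of_curlK_ne_zero x.toKIdx h
    · subst hm
      fin_cases m <;> simp [edgeY]
  rcases key with h | h | h
  · exact Or.inl h.symm
  · exact Or.inr (Or.inl (by rw [h, OpsYNablaBridge.unshift_shift]))
  · exact Or.inr (Or.inr (by rw [h, OpsYNablaBridge.unshift_shift]))

/-- ★ **`agree310WalkYO near □ U U′` WITH `bondReadSetY S ⊆ near □` GIVES CLAUSES (i)–(iii) OF `AgreeDirBY`** (and clause (iv) from the dependency-set inclusion).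
[cite: Balaban1985BackgroundPropagators, p.410 L14–15, (3.100) p.413, dictionary] -/
theorem agreeDirBY_of_agree310WalkYO (near : ↥(cubes x.toKIdx.D.toDomains) → Finset (SiteY x.toKIdx)) (S : Finset (SiteY x.toKIdx))
    (D : IBondY x.toKIdx → Set (FBondY x.toKIdx)) (hS : bondReadSetY x.toKIdx c S ⊆ near c)
    (hD : ∀ ι, (∃ b ∈ D ι, chartY x.toKIdx b.src ∈ S) → ∀ b' ∈ D ι, chartY x.toKIdx b'.src ∈ near c) {U U' : B.Cfg}
    (h : agree310WalkYO x B cfg near c U U') : AgreeDirBY x.toKIdx c D S (cfg U) (cfg U') := by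
  have hfwd : ∀ w : Site (PV d ℓ x.toKIdx.m x.toKIdx.K hd hL) 0, chartY x.toKIdx w ∈ near c → ∀ μ, cfg U μ w = cfg U' μ w := fun w hw μ => by
    rw [← UboxY_chartY x.toKIdx (cfg U), ← UboxY_chartY x.toKIdx (cfg U')]
    exact (h _ hw μ).1
  refine ⟨fun z hz μ => h z (hS (mem_bondReadSetY_self hz)) μ, fun v hv μ => (h v (hS (mem_bondReadSetY_of_mem_blkHullCubeY hv)) μ).1,
    fun b hb p hp => ?_, fun ι hι b' hb' => hfwd _ (hD ι hι b' hb') _⟩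
  -- the plaquette's corner and its two forward-shifted corners are read sites
  have hsrc : chartY x.toKIdx p.src ∈ near c ∧ ∀ κ, chartY x.toKIdx (p.src.shift κ) ∈ near c := by
    rcases plaq_src_of_row x hp with e | e | e
    · refine ⟨hS (e ▸ mem_bondReadSetY_self hb), fun κ => hS ?_⟩
      rw [← shiftY_chartY, e]; exact shiftY_mem_bondReadSetY hb κ
    · refine ⟨hS ?_, fun κ => hS ?_⟩
      · rw [e, ← shiftY_symm_chartY]; exact shiftY_symm_mem_bondReadSetY hb _
      · rw [← shiftY_chartY, e, ← shiftY_symm_chartY]; exact shiftY_shiftY_symm_mem_bondReadSetY hb _ _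
    · refine ⟨hS ?_, fun κ => hS ?_⟩
      · rw [e, ← shiftY_symm_chartY]; exact shiftY_symm_mem_bondReadSetY hb _
      · rw [← shiftY_chartY, e, ← shiftY_symm_chartY]; exact shiftY_shiftY_symm_mem_bondReadSetY hb _ _
  exact ⟨hfwd _ hsrc.1 _, hfwd _ hsrc.1 _, hfwd _ (hsrc.2 _) _, hfwd _ (hsrc.2 _) _⟩

/-- ★★★ **THE `hOagrA` ROW OF THE (γ) HEADS**: the bond-sector walk reading's agreement predicate `agree310WalkYO near □ U U′` gives
`G_□(U) = G_□(U′)` at the bond letter of record `GDirBY 𝔮 𝔮⋆ (DPDsDirCubeY x.toKIdx □ S) (bondsOverY S)` whenever the reading domain `near □` contains the reading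
set `bondReadSetY x.toKIdx □ S` and the source sites of every dependency set of the averaging letter meeting the bonds over `S`, given (L2) `IsLocalQ D 𝔮` and the
row locality `IsLocalQs D 𝔮⋆` (for `𝔮⋆ = adjTrY ∘ 𝔮`: ✓`isLocalQs_adjTrY`). [cite: Balaban1985BackgroundPropagators, p.410 L14–15 («depend on U restricted to Ω₀(□) ⊂ □̃⁵»), p.413, p.409 l.3–5] -/
theorem GDirBY_DPDsDirCubeY_congr_of_agree310WalkYO (near : ↥(cubes x.toKIdx.D.toDomains) → Finset (SiteY x.toKIdx)) (S : Finset (SiteY x.toKIdx))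
    {D : IBondY x.toKIdx → Set (FBondY x.toKIdx)} {𝔮 : QLetterY 𝔸 x.toKIdx} {𝔮s : QsLetterY 𝔸 x.toKIdx} (hloc : IsLocalQ D 𝔮) (hlocs : IsLocalQs x.toKIdx D 𝔮s)
    (hS : bondReadSetY x.toKIdx c S ⊆ near c) (hD : ∀ ι, (∃ b ∈ D ι, chartY x.toKIdx b.src ∈ S) → ∀ b' ∈ D ι, chartY x.toKIdx b'.src ∈ near c)
    {U U' : B.Cfg} (h : agree310WalkYO x B cfg near c U U') :
    GDirBY x.toKIdx 𝔮 𝔮s (DPDsDirCubeY x.toKIdx c S) (bondsOverY x.toKIdx S) (cfg U) = GDirBY x.toKIdx 𝔮 𝔮s (DPDsDirCubeY x.toKIdx c S) (bondsOverY x.toKIdx S) (cfg U') :=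
  GDirBY_DPDsDirCubeY_congr x.toKIdx c hloc hlocs S (agreeDirBY_of_agree310WalkYO x B cfg c near S D hS hD h)

/-- ★★ and the regime hypotheses of record agree under the same reading. [cite: Balaban1985BackgroundPropagators, p.409 l.3–5, Cor. 3.6 p.408, p.410 L14–15] -/
theorem isUnit_padDeltaLocBY_DPDsDirCubeY_iff_of_agree310WalkYO (near : ↥(cubes x.toKIdx.D.toDomains) → Finset (SiteY x.toKIdx)) (S : Finset (SiteY x.toKIdx))
    {D : IBondY x.toKIdx → Set (FBondY x.toKIdx)} {𝔮 : QLetterY 𝔸 x.toKIdx} {𝔮s : QsLetterY 𝔸 x.toKIdx} (hloc : IsLocalQ D 𝔮) (hlocs : IsLocalQs x.toKIdx D 𝔮s)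
    (hS : bondReadSetY x.toKIdx c S ⊆ near c) (hD : ∀ ι, (∃ b ∈ D ι, chartY x.toKIdx b.src ∈ S) → ∀ b' ∈ D ι, chartY x.toKIdx b'.src ∈ near c)
    {U U' : B.Cfg} (h : agree310WalkYO x B cfg near c U U') :
    IsUnit (padDeltaLocBY x.toKIdx 𝔮 𝔮s (DPDsDirCubeY x.toKIdx c S) (bondsOverY x.toKIdx S) (cfg U)) ↔
      IsUnit (padDeltaLocBY x.toKIdx 𝔮 𝔮s (DPDsDirCubeY x.toKIdx c S) (bondsOverY x.toKIdx S) (cfg U')) :=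
  isUnit_padDeltaLocBY_DPDsDirCubeY_iff x.toKIdx c hloc hlocs S (agreeDirBY_of_agree310WalkYO x B cfg c near S D hS hD h)

end Member

end Literature.MathematicalPhysics.QuantumFieldTheory.Balaban1983to89.B9CubeDirInverseBondLocalityAtRecordY

end
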